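import Summits.BirchSwinnertonDyer.BirchSwinnertonDyer.Theses.PrintX10b
import Summits.BirchSwinnertonDyer.BirchSwinnertonDyer.Theorems.ConjSpanGenAllLevels
import Summits.BirchSwinnertonDyer.BirchSwinnertonDyer.Theorems.TheoremBStub2X10b
import Summits.BirchSwinnertonDyer.BirchSwinnertonDyer.Theorems.PrintX10bAnalyticMuZeroX10bStubUnitMeasureOfNonconstancy
import Summits.BirchSwinnertonDyer.BirchSwinnertonDyer.Theorems.PrintX10bAnalyticMuZeroX10bStubMuAnZeroOfUnitMeasure
import Summits.BirchSwinnertonDyer.Rank1Residual.X10.ClassX10bLeaf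
import Summits.BirchSwinnertonDyer.Rank1Residual.X10.LeafDischargeX10b
import HarnessLib

set_option linter.dupNamespace false

/-!
# Route `PrintX10b`, crux `AnalyticMuZeroX10bOfInputs` (stmt-BirchSwinnertonDyer-22502; rung W-ALL/10 μ-half) — CLOSED

`TheoremBInputsX10b → AnalyticMuZeroX10b`: from the two published inputs (L) = Morris 2007 Thm 6.1(2)
(`Morris2007.thm61_2_elementary_boundedlyGenerates`) and (C) = Serre 1970 §2.6 (`SerreSL2Congruence1970_congruenceSubgroupProperty_away`),
both landed cite-only named facts, Greenberg's analytic μ-invariant of the 3-adic L-function vanishes for every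
globally minimal E/ℚ good ordinary at 3 with E[3] irreducible and ρ̄_{E,3} not surjective (class X10b) — in fact for
every such pair the power series has a unit coefficient.  The proof is LINE B (`Cruxes/AnalyticMuZeroX10b/Lines/theoremB_x10b.lean`,
skeleton v4 41c1930e4741df0b, cell bsd-f3-mu) read over the TREE: stub 1b = THEOREM B `conjSpanGenAll_of_morris_of_serre`
(bsd-print-x8, `Theorems/ConjSpanGenAllLevels.lean`), stub 2 = vertical Stevens / Ash–Stevens non-constancy of the cyclotomic
winding classes (`Theorems/TheoremBStub2X10b.lean` over `PrintX8VerticalStevensIrreducible`), stub 3a = unit measure value from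
non-constancy (`Theorems/PrintX10bAnalyticMuZeroX10bStubUnitMeasureOfNonconstancy.lean`, -an g5 mathematics, p1 landing p572034), stub 3b = unit coefficient from a unit measure value at
p = 3 (`Theorems/PrintX10bAnalyticMuZeroX10bStubMuAnZeroOfUnitMeasure.lean`, bsd-print-x9 p2).  No named fact beyond (L), (C) enters;
the unconditional text `AnalyticMuZeroX10b` (stmt-20682) stays open for the (K-b) port of Vaserstein's theorem to `Localization.Away`.
[cite: Morris2007, Thm. 6.1(2)] [cite: SerreSL2Congruence1970, §2.6 Thm. 2, Cor. 1–3] [cite: GreenbergVatsal2000, Thm. (1.3) context]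
-/

namespace Summit.BirchSwinnertonDyer.BirchSwinnertonDyer.Theorems.PrintX10bAnalyticMuZeroX10bOfInputs

open scoped Classical
open CongruenceSubgroup WeierstrassCurve
open Literature.NumberTheory.EllipticCurves
open Literature.NumberTheory.EllipticCurves.ModularForms
open Literature.NumberTheory.EllipticCurves.Rank1Residual
open Summit.BirchSwinnertonDyer.Rank1Residual.X10
open Summit.BirchSwinnertonDyer.BirchSwinnertonDyer.Cruxes.AnalyticMuZeroX10b.TheoremB
  (stub_nonconstancy_of_theoremB stub_unitMeasure_of_nonconstancy stub_muAnZero_of_unitMeasure)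
open Summit.BirchSwinnertonDyer.BirchSwinnertonDyer.Theorems.ConjSpanGenAllLevels (conjSpanGenAll_of_morris_of_serre)
open Summit.BirchSwinnertonDyer.BirchSwinnertonDyer.Theses.PrintX10b (AnalyticMuZeroX10b TheoremBInputsX10b
  AnalyticMuZeroX10bOfInputs)

/-- **(L) ∧ (C) ⟹ analytic μ₃ = 0 on class X10b** (the LINE B composition over the tree's stub theorems).
[cite: Morris2007, Thm. 6.1(2)] [cite: SerreSL2Congruence1970, §2.6] -/
theorem analyticMuZeroX10b_of_morris_of_serre
    (hL : Literature.GroupTheory.ArithmeticGroups.Morris2007.thm61_2_elementary_boundedlyGenerates)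
    (hC : Literature.NumberTheory.Automorphic.SerreSL2Congruence1970_congruenceSubgroupProperty_away) :
    AnalyticMuZeroX10b := by
  intro W _ _ p _ N _ f hX _hns hf
  obtain ⟨rfl, -⟩ := id hX
  exact stub_muAnZero_of_unitMeasure W f hX.isOrdinaryAt_three hf hX.irr_three
    (stub_unitMeasure_of_nonconstancy W f hX.isOrdinaryAt_three hf hX.irr_three
      (stub_nonconstancy_of_theoremB
        (fun M q hq hqM => conjSpanGenAll_of_morris_of_serre hL hC M q hq hqM) W 3 (by decide)
        hX.isOrdinaryAt_three.1 hX.irr_three))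

/-- **The crux `AnalyticMuZeroX10bOfInputs` of route `PrintX10b` holds** (item stmt-BirchSwinnertonDyer-22502):
`TheoremBInputsX10b → AnalyticMuZeroX10b`. [cite: Morris2007, Thm. 6.1(2)] [cite: SerreSL2Congruence1970, §2.6] -/
theorem analyticMuZeroX10bOfInputs_holds : AnalyticMuZeroX10bOfInputs :=
  fun hI => analyticMuZeroX10b_of_morris_of_serre hI.1 hI.2

end Summit.BirchSwinnertonDyer.BirchSwinnertonDyer.Theorems.PrintX10bAnalyticMuZeroX10bOfInputs
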